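import Summits.HodgeConjecture.HodgeConjecture.Theses.GenericDivisibility
import Summits.HodgeConjecture.HodgeConjecture.Theorems.GenericDivisibilityHodgeClassesGenericallyDivisibleStubBockstein
import Summits.HodgeConjecture.HodgeConjecture.Theorems.GenericDivisibilityHodgeClassesGenericallyDivisibleStubCoprimeAssembly
import Summits.HodgeConjecture.HodgeConjecture.Theorems.GenericDivisibilityHodgeClassesGenericallyDivisibleStubModularConiveauOfDivisible
import Mathlib.Data.Nat.Factorization.Induction
import HarnessLib

/-!
# Route GenericDivisibility — crux `HodgeClassesGenericallyDivisible` (C1, stmt-HodgeConjecture-18466), line `Sketch`: the reduction theorem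

The line `Sketch` of the crux C1 (lead skeleton `Cruxes/HodgeClassesGenericallyDivisible/Lines/Sketch.lean`)
reduces C1 — "an integral middle-degree Hodge class on a smooth projective complex `2p`-fold is, for
every `m ≥ 1`, divisible by `m` on the complex points of some non-empty Zariski open" — to finite
coefficients.  This file lands, sorry-free, the COMPOSITION of that skeleton with its open stub turned
into an explicit hypothesis, and the resulting EQUIVALENCE (the line's registered stub
`stub_cruxIffPrimePowerModularConiveau`):

  C1 ⟺ for every such `(X, z)`, every prime `ℓ` and every `r ≥ 1`, the reduction
        `z mod ℓʳ ∈ H²ᵖ(X(ℂ); ℤ/ℓʳ)` lies in `N¹ H²ᵖ(X(ℂ); ℤ/ℓʳ) = coniveauFiltration (ZMod (ℓ^r)) X (2p) 1`.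

`⇐` (`hodgeClassesGenericallyDivisible_of_primePowerModularConiveau`): induct on `m` along its prime
factorisation (`Nat.recOnPosPrimePosCoprime`); a prime power is "unfold `N¹` to a proper closed `Z`
(`mem_coniveauFiltration_iff_exists`, irreducibility), move the reduction past the restriction
(`genericDivisibility_restrictToCompl_ringChange_zmod`), Bockstein exactness on `(X ∖ Z)(ℂ)`
(`stub_bockstein`, landed)"; coprime factors glue by `stub_coprimeAssembly` (landed).
`⇒` (`primePowerModularConiveau_of_hodgeClassesGenericallyDivisible`): C1 at `m = ℓʳ` and the landed
converse `stub_modularConiveau_of_divisible`.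

So the one open stub of the line is the crux itself in the finite-coefficient language that all three
cards of the line (`phantom-calculus`, `ordinary-inertia-rigidity`, `special-fibre-transfer`) speak —
nothing weaker than C1 closes it (strategist census: HC-middle strength; disprover cycle 1: no kill,
target-implied).  (The line's diagnostic `stub_onePrimeSupported` — one-prime principle ⇒
rational coniveau one — is landed separately in `…StubOnePrimeSupported.lean`.)
-/

-- mandated `Summit.HodgeConjecture.HodgeConjecture.…` namespace (single-problem summit) trips
-- `linter.dupNamespace`; off tree-wide in the lakefile, restated for stand-alone elaboration.
set_option linter.dupNamespace false

noncomputable section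

namespace Summit.HodgeConjecture.HodgeConjecture.Theorems

open CategoryTheory AlgebraicGeometry
open Literature.AlgebraicGeometry.Motives Literature.AlgebraicGeometry.HodgeTheory
  Literature.AlgebraicTopology.SingularHomology
open Summit.HodgeConjecture.HodgeConjecture.Theses.GenericDivisibility

/-- **Modular coniveau one at `m ≥ 1` ⇒ divisible by `m` on a non-empty Zariski open.** On an
irreducible `ℂ`-scheme, if `z mod m ∈ N¹ H^q(X(ℂ); ℤ/m)` then `z|_{(X∖Z)(ℂ)} = m • y` for some proper
closed `Z`: unfold `N¹` (`mem_coniveauFiltration_iff_exists`; every point of `Z` has codimension `≥ 1`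
iff `Z ≠ X`), move the reduction modulo `m` past the restriction, and apply Bockstein exactness
(`stub_bockstein`, Hatcher §3.E) on `(X ∖ Z)(ℂ)`. [cite: BlochOgus1974ENS, (3.8)] [cite: HatcherAT2002, §3.E p. 303] -/
theorem genericDivisibility_divisibleOnOpen_of_modularConiveau {X : SchemeOver ℂ}
    [IrreducibleSpace X.left] {q m : ℕ} (hm : 1 ≤ m) (z : singularCohomology ℤ ℤ (ComplexPoints X) q)
    (hz : singularCohomology.ringChange (Int.castRingHom (ZMod m)) (ComplexPoints X) q z ∈
      coniveauFiltration (ZMod m) X q 1) :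
    ∃ Z : Set X.left, IsClosed Z ∧ Z ≠ Set.univ ∧
      ∃ y : singularCohomology ℤ ℤ (complexPointsCompl X Z) q, m • y = restrictToCompl ℤ X q Z z := by
  obtain ⟨Z, hZ, hr1, h0⟩ := (mem_coniveauFiltration_iff_exists (ZMod m) q).1 hz
  refine ⟨Z, hZ, (forall_one_le_coheight_iff_ne_univ hZ).1 hr1, ?_⟩
  have h1 : singularCohomology.ringChange (Int.castRingHom (ZMod m)) (complexPointsCompl X Z) q
      (restrictToCompl ℤ X q Z z) = 0 := by
    rw [← genericDivisibility_restrictToCompl_ringChange_zmod]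
    exact h0
  obtain ⟨y, hy⟩ := stub_bockstein q m hm _ h1
  exact ⟨y, hy.symm⟩

/-- **Line `Sketch`, composition: prime-power modular coniveau one of Hodge classes ⇒ C1.** If for
every `p ≥ 1`, every smooth projective complex `2p`-fold `X`, every integral class `z` with `(p,p)`
complexification, every prime `ℓ` and `r ≥ 1` one has `z mod ℓʳ ∈ N¹ H²ᵖ(X(ℂ); ℤ/ℓʳ)`, then
`HodgeClassesGenericallyDivisible`: induct on `m ≥ 1` along its factorisation
(`Nat.recOnPosPrimePosCoprime`) — `m = 1` is `y = z|` off `∅`, a prime power is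
`genericDivisibility_divisibleOnOpen_of_modularConiveau`, coprime factors glue by
`stub_coprimeAssembly` (`X` irreducible). [cite: BlochOgus1974ENS, (3.8)] -/
theorem hodgeClassesGenericallyDivisible_of_primePowerModularConiveau
    (h : ∀ ⦃p : ℕ⦄ ⦃X : SchemeOver ℂ⦄, 1 ≤ p → IsSmoothProjective (2 * p) X →
      ∀ z : singularCohomology ℤ ℤ (ComplexPoints X) (2 * p),
        IsOfHodgeType (2 * p) X (2 * p) p p
          (singularCohomology.ringChange (Int.castRingHom ℂ) (ComplexPoints X) (2 * p) z) →
        ∀ (ℓ r : ℕ), ℓ.Prime → 1 ≤ r →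
          singularCohomology.ringChange (Int.castRingHom (ZMod (ℓ ^ r))) (ComplexPoints X) (2 * p) z ∈
            coniveauFiltration (ZMod (ℓ ^ r)) X (2 * p) 1) :
    HodgeClassesGenericallyDivisible := by
  unfold Summit.HodgeConjecture.HodgeConjecture.Theses.GenericDivisibility.HodgeClassesGenericallyDivisible
  intro p X hp hX z hz m hm
  haveI := hX.geometricallyIrreducible
  haveI : IrreducibleSpace X.left :=
    AlgebraicGeometry.GeometricallyIrreducible.irreducibleSpace_of_subsingleton X.hom
  change ∃ Z : Set X.left, IsClosed Z ∧ Z ≠ Set.univ ∧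
    ∃ y : singularCohomology ℤ ℤ (complexPointsCompl X Z) (2 * p), m • y = restrictToCompl ℤ X (2 * p) Z z
  revert hm
  induction m using Nat.recOnPosPrimePosCoprime with
  | prime_pow ℓ r hℓ hr =>
    intro _
    exact genericDivisibility_divisibleOnOpen_of_modularConiveau (Nat.one_le_pow r ℓ hℓ.pos) z
      (h hp hX z hz ℓ r hℓ hr)
  | zero => intro h0; exact absurd h0 (by omega)
  | one =>
    intro _
    exact ⟨∅, isClosed_empty, fun h0 ↦ (Set.empty_ne_univ h0).elim, restrictToCompl ℤ X (2 * p) ∅ z,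
      one_smul ℕ _⟩
  | coprime a b ha hb hab iha ihb =>
    intro _
    exact stub_coprimeAssembly (2 * p) z a b hab (iha (by omega)) (ihb (by omega))

/-- **The converse: C1 ⇒ prime-power modular coniveau one** (C1 at `m = ℓʳ`, then the landed
`stub_modularConiveau_of_divisible`: `m • y` reduces to `0` with `ℤ/m`-coefficients). [cite: BlochOgus1974ENS, (3.8)] -/
theorem primePowerModularConiveau_of_hodgeClassesGenericallyDivisible
    (hC : HodgeClassesGenericallyDivisible) :
    ∀ ⦃p : ℕ⦄ ⦃X : SchemeOver ℂ⦄, 1 ≤ p → IsSmoothProjective (2 * p) X →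
      ∀ z : singularCohomology ℤ ℤ (ComplexPoints X) (2 * p),
        IsOfHodgeType (2 * p) X (2 * p) p p
          (singularCohomology.ringChange (Int.castRingHom ℂ) (ComplexPoints X) (2 * p) z) →
        ∀ (ℓ r : ℕ), ℓ.Prime → 1 ≤ r →
          singularCohomology.ringChange (Int.castRingHom (ZMod (ℓ ^ r))) (ComplexPoints X) (2 * p) z ∈
            coniveauFiltration (ZMod (ℓ ^ r)) X (2 * p) 1 := by
  intro p X hp hX z hz ℓ r hℓ _
  haveI := hX.geometricallyIrreducible
  haveI : IrreducibleSpace X.left :=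
    AlgebraicGeometry.GeometricallyIrreducible.irreducibleSpace_of_subsingleton X.hom
  exact stub_modularConiveau_of_divisible (2 * p) (ℓ ^ r) z
    (hC hp hX z hz (ℓ ^ r) (Nat.one_le_pow r ℓ hℓ.pos))

/-- **Registered stub `stub_cruxIffPrimePowerModularConiveau` of line `Sketch`: the one open stub of
the line is EQUIVALENT to the crux.** `HodgeClassesGenericallyDivisible` holds iff every integral
middle-degree Hodge class on every smooth projective complex `2p`-fold (`p ≥ 1`) has mod-`ℓʳ`
reduction of coniveau `≥ 1` for every prime power `ℓʳ` (`r ≥ 1`).  Closing the stub closes the crux,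
and nothing weaker than the crux closes the stub. [cite: BlochOgus1974ENS, (3.8)] [cite: ColliotTheleneVoisin2012, §3] -/
theorem stub_cruxIffPrimePowerModularConiveau :
    (∀ ⦃p : ℕ⦄ ⦃X : SchemeOver ℂ⦄, 1 ≤ p → IsSmoothProjective (2 * p) X →
      ∀ z : singularCohomology ℤ ℤ (ComplexPoints X) (2 * p),
        IsOfHodgeType (2 * p) X (2 * p) p p
          (singularCohomology.ringChange (Int.castRingHom ℂ) (ComplexPoints X) (2 * p) z) →
        ∀ (ℓ r : ℕ), ℓ.Prime → 1 ≤ r →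
          singularCohomology.ringChange (Int.castRingHom (ZMod (ℓ ^ r))) (ComplexPoints X) (2 * p) z ∈
            coniveauFiltration (ZMod (ℓ ^ r)) X (2 * p) 1) ↔
      HodgeClassesGenericallyDivisible :=
  ⟨hodgeClassesGenericallyDivisible_of_primePowerModularConiveau,
    primePowerModularConiveau_of_hodgeClassesGenericallyDivisible⟩

end Summit.HodgeConjecture.HodgeConjecture.Theorems

end
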